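import Literature.Geometry.Lorentzian.ErnstBalanceCandidates

/-!
# Neugebauer–Hennig: no stationary equilibrium of two aligned sub-extremal vacuum black holes

Topic `Literature/Geometry/Lorentzian`, sub-namespace `Ernst` (cite item wi-37348; wanted by the
`SOS × balance` line on crux `stmt-FinalStateConjecture-10078`, stub `n = 2`). Companion of
`ErnstBalanceCandidates.lean`, in exactly its vocabulary: the semialgebraic candidate set
`balanceCandidatesTwo = balanceCandidates 2 strutFreeTwo ⊆ BalanceParams 2` of LP/axis data of a
stationary, axisymmetric, asymptotically flat VACUUM configuration of two aligned rotating black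
holes with extended horizons `K₁ > K₂ > K₃ > K₄` (Hennig's parameter conditions `tr r⁺ ≡ 0` —
equivalent to the axis conditions `a⁺ = a⁰ = a⁻` [NeugebauerHennig2012 §4.3: "constraints (traf)
and restrictions (ap) are equivalent formulations"] — consistency of the reduced axis data,
NUT-freeness, the printed strut condition `α₁α₂ + α₃α₄ = 0`, and sub-extremality `8π|Jᵢ| < Aᵢ`
of both horizons).

## The printed theorem (held text `paper:arxiv-1105.5830`)

G. Neugebauer, J. Hennig, *Stationary two-black-hole configurations: a non-existence proof*,
J. Geom. Phys. 62 (2012) 613–630 [NeugebauerHennig2012], announced in Gen. Relativ. Gravit. 41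
(2009) 2113 [NeugebauerHennig2009]; degenerate horizons in [HennigNeugebauer2011].

* §4 (boundary problem): integrating the linear problem of the Ernst equation along the axis, the
  two horizons and infinity shows that the Ernst potential of any such configuration is a member
  of the double-Kerr–NUT family whose parameters `αᵢ, Kᵢ` (`i = 1,…,4`) satisfy the axis
  equilibrium conditions `a⁺ = a⁰`, `a⁻ = a⁰` (⇔ `tr R⁺ = 0`, §4.3).
* §5: the no-strut condition `e^{2k⁰} = 1` on the inner axis segment "has two solution branches,
  `H⁰ = ±H⁺`. Tomimatsu and Kihara ruled out the condition `H⁰ = H⁺` (… overlapping horizons).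
  `H⁰ = −H⁺` yields `α₁α₂ + α₃α₄ = 0`" — the tree's `strutFreeTwo`.
* §6.1, verbatim: "In a regular spacetime with two sub-extremal black holes, both black holes
  have to satisfy this inequality individually, `8π|Jᵢ| < Aᵢ`, `i = 1, 2`. … For
  `K₁ > K₂ > K₃ > K₄` these conditions can be written as `α₁α₂ + α₃α₄ = 0` and
  `((1−α₄)²/α₄) w² = (1−α₃)²/α₃`, `w := √(K₁₄K₂₄/(K₁₃K₂₃)) ∈ [1,∞)`,
  `((1+α₂)²/α₂) w′² = (1+α₁)²/α₁`, `w′ := √(K₂₃K₂₄/(K₁₃K₁₄)) ∈ (0,1]`. As shown by Manko et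
  al. these equations can be explicitly solved for `α₁,…,α₄` [in terms of `w, w′, α = e^{iφ}`,
  `ε = ±1`]. … `pᵢ := 8πJᵢ/Aᵢ`: `p₁ = ε(1+Φw′)/(w′(Φ+w′))`, `p₂ = ε w(w−Φ)/(1−wΦ)`,
  `Φ := cos φ + ε sin φ`. Rewriting the inequalities as `pᵢ² < 1` we find the two conditions
  `w′² + 2Φw′ + 1 < 0` and `w² − 2Φw + 1 < 0`. Since the latter inequalities imply `Φw′ < 0` and
  `Φw > 0`, we arrive at a contradiction, because `w` and `w′` are positive. In this way, we have
  shown that two sub-extremal black holes cannot be in equilibrium."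

## What is recorded

* The theorem as ONE named fact (D-0014; Literature is sorry-free, users take
  `(h : NeugebauerHennig2012_balanceCandidatesTwo_eq_empty)`): `balanceCandidatesTwo = ∅`. This
  is the extended-horizon case (i) of the paper's summary (§7); `BalanceParams.Admissible` asks
  `K₁ > K₂ > K₃ > K₄`, so the degenerate cases (ii), (iii) (§§6.2–6.3, [HennigNeugebauer2011])
  are not part of the statement — it is WEAKER than print, never stronger. NUT-freeness is an
  extra conjunct of the candidate set (asymptotic flatness, boundary condition (B3) of the paper),
  again only shrinking it.
* The terminal real-algebraic step of §6.1 as a PROVED lemma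
  (`NeugebauerHennig2012_subextremal_contradiction`): for `w, w′ > 0` and any real `Φ` the two
  printed inequalities are contradictory.

What is NOT here: the Manko et al. parametrisation `(w, w′, φ, ε)` of the strut-free family and
the computation of `p₁, p₂` (§6.1, [MankoRuiz2001]) — that is the content of the fact; the
degenerate cases; electrovacuum.

## References

* [NeugebauerHennig2012] G. Neugebauer, J. Hennig, J. Geom. Phys. 62 (2012) 613,
  arXiv:1105.5830, §4.3, §5, §6.1 (p. 16 of the arXiv version), §7.
* [NeugebauerHennig2009] G. Neugebauer, J. Hennig, Gen. Relativ. Gravit. 41 (2009) 2113,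
  arXiv:0905.4179, §4.
* [HennigNeugebauer2011] J. Hennig, G. Neugebauer, Gen. Relativ. Gravit. 43 (2011) 3139,
  arXiv:1103.5248.
* [MankoRuiz2001] V. S. Manko, E. Ruiz, Class. Quantum Grav. 18 (2001) L11.
-/

noncomputable section

namespace Literature.Geometry.Lorentzian.Ernst

/-- **Neugebauer–Hennig non-existence theorem (two extended horizons).** In the tree's
coordinates: Hennig's candidate set for `n = 2` with the printed strut condition is EMPTY — no
admissible LP/axis data (`K₁ > K₂ > K₃ > K₄`, `Ωᵢ ≠ 0`) satisfy the parameter conditions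
`tr r⁺ ≡ 0` (⇔ axis regularity `a⁺ = a⁰ = a⁻`), consistency of the reduced axis data,
NUT-freeness, strut-freeness `α₁α₂ + α₃α₄ = 0` and sub-extremality `8π|Jᵢ| < Aᵢ` of both
horizons; informally: there is no stationary, axisymmetric, asymptotically flat vacuum spacetime
containing two aligned, separated, sub-extremal (extended-horizon) black holes in strut-free
equilibrium. (Printed proof: boundary problem ⇒ double-Kerr–NUT with `a⁺ = a⁰ = a⁻`; Manko et
al.'s solution of the equilibrium conditions in `(w, w′, φ, ε)`; `pᵢ = 8πJᵢ/Aᵢ` give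
`w′² + 2Φw′ + 1 < 0 ∧ w² − 2Φw + 1 < 0`, impossible for `w, w′ > 0`, see
`NeugebauerHennig2012_subextremal_contradiction`.) Degenerate horizons ([HennigNeugebauer2011])
are outside `Admissible` and not claimed.
[cite: NeugebauerHennig2012, §6.1 (p. 16) with §4.3, §5, §7 (i); NeugebauerHennig2009 §4] -/
def NeugebauerHennig2012_balanceCandidatesTwo_eq_empty : Prop :=
  balanceCandidatesTwo = ∅

/-- Unfolding: the fact says no `p : BalanceParams 2` lies in `balanceCandidates 2 strutFreeTwo`.
[cite: NeugebauerHennig2012, §6.1] -/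
theorem NeugebauerHennig2012_balanceCandidatesTwo_eq_empty.not_mem
    (h : NeugebauerHennig2012_balanceCandidatesTwo_eq_empty) (p : BalanceParams 2) :
    p ∉ balanceCandidates 2 strutFreeTwo := by
  change p ∉ balanceCandidatesTwo
  rw [h]
  exact Set.notMem_empty p

/-- Consequence used by balance lines: admissible, consistent, NUT-free, strut-free `n = 2` data
violate sub-extremality at some horizon. [cite: NeugebauerHennig2012, §6.1 ("two sub-extremal
black holes cannot be in equilibrium")] -/
theorem NeugebauerHennig2012_balanceCandidatesTwo_eq_empty.not_subextremal
    (h : NeugebauerHennig2012_balanceCandidatesTwo_eq_empty) {p : BalanceParams 2}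
    (hadm : p.Admissible) (hpar : p.ParamConditions) (hcons : p.AxisDataConsistent)
    (hnut : p.NutFree) (hstrut : strutFreeTwo p) : ¬ p.Subextremal := fun hsub =>
  h.not_mem p ⟨hadm, hpar, hcons, hnut, hstrut, hsub⟩

/-- **The terminal step of [NeugebauerHennig2012, §6.1]** (proved): for positive `w, w′` and real
`Φ` the printed sub-extremality conditions `w′² + 2Φw′ + 1 < 0` and `w² − 2Φw + 1 < 0` are
contradictory (the first forces `Φ < 0`, the second `Φ > 0`).
[cite: NeugebauerHennig2012, §6.1 (last display of the subsection and the sentence after it)] -/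
theorem NeugebauerHennig2012_subextremal_contradiction {w w' Φ : ℝ} (hw : 0 < w)
    (hw' : 0 < w') : ¬ (w' ^ 2 + 2 * Φ * w' + 1 < 0 ∧ w ^ 2 - 2 * Φ * w + 1 < 0) := by
  rintro ⟨h1, h2⟩
  have hΦneg : Φ < 0 := by
    by_contra hΦ
    have hΦ : 0 ≤ Φ := le_of_not_gt hΦ
    nlinarith [sq_nonneg w', mul_nonneg hΦ hw'.le]
  have hΦpos : 0 < Φ := by
    by_contra hΦ
    have hΦ : Φ ≤ 0 := le_of_not_gt hΦ
    nlinarith [sq_nonneg w, mul_nonneg (neg_nonneg.mpr hΦ) hw.le]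
  exact lt_irrefl _ (hΦneg.trans hΦpos)

end Literature.Geometry.Lorentzian.Ernst

end
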